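import Summits.ABC.ABC.Theorems.CuspFieldPencilNFPencilOfScoones
import HarnessLib

/-!
# STUB-IDEAS k1 · gen 19 — companion sketch for `stub_complexCubic` (crux stmt-ABC-22740 `IndexSzpiro`)

FAMILY 1 (RECOGNISE & IMPORT), tree match: the ONE polynomial-currency Diophantine engine that landed in the
tree since the route was born — `Summit.ABC.ABC.Theorems.NFPencilOfScoones.threeForms_of_scoones2021`
(number-field Stewart–Yu, Scoones 2023 Thm 3, class-number-one form; PROVED-MOD-FACT, 2026-08-28) — is
instantiated on the stub's kill pencil `K = ℚ(∛2)` (`P_n : y² = x³ − 6nx − (4n³+2)`, `Δ = −1728(2n³−1)²`,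
G13) through the `n`-FREE Siegel identity over the splitting field `L = ℚ(∛2, ζ₃)` (`h_L = 1`):
the three forms `Lᵢ(u,w) = αᵢu − w` (`αᵢ` the roots of `X³ − 2`) at `(u,w) = (n,1)` have product `2n³ − 1`,
so the engine pays `log|n| ≤ C_ε · rad(2n³−1)^{[L:ℚ]/3 + ε} = C_ε · rad(2n³−1)^{2+ε}`, i.e.
`rad(2n³ − 1) ≫ (log n)^{1/2 − ε}` — where the stub demands `rad(2n³−1) ≫ n^{1−δ}` (G13
`cubicValueRadicalBound_of_stub`). Calibration of the engine against the stub; nothing here proves the stub.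

Items: H1a/H1b/H1c (S, algebra, PROVED here), H2 (M⁻, PROVED here), H3 (S, PROVED here), RUNG (M⁻, sorry: one prover
cycle from `threeForms_of_scoones2021` + H1–H3), H0 (INPUT: `h(ℚ(∛2,ζ₃)) = 1`, LMFDB 6.0.34992.1 — NOT a
one-cycle item), COROLLARY `killPencilLogRung_two` (kernel-checked composition), CAL (S, sorry).
-/

set_option linter.dupNamespace false

noncomputable section

namespace Summit.ABC.ABC.Cruxes.IndexSzpiro.StubIdeas1G19

open Polynomial UniqueFactorizationMonoid WeierstrassCurve NumberField
open Literature.NumberTheory.DiophantineGeometry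

/-- The stub, verbatim (payload `stub.signature`). -/
def Stub : Prop :=
  ∀ ε : ℝ, 0 < ε → ∃ C : ℝ, ∀ (W : WeierstrassCurve ℚ) [W.IsElliptic] (K : Type) [Field K] [NumberField K],
    Irreducible W.twoTorsionPolynomial.toPoly → Module.finrank ℚ K = 3 →
    (∃ θ : K, aeval θ W.twoTorsionPolynomial.toPoly = 0) → NumberField.discr K < 0 →
    (W.minimalDiscriminantNorm ℤ : ℝ) ≤ C * |(NumberField.discr K : ℝ)| * (W.conductorNorm ℤ : ℝ) ^ (6 + ε)

/-- G13's weakest instance of the stub (verbatim copy of `StubIdeasComplexCubic1G13.CubicValueRadicalBound`):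
`|2n³ − 1| ≤ C(ε)·rad(2n³ − 1)^{3+ε}`, i.e. `rad(2n³−1) ≫ n^{1−δ}` — the `y = 1` slice of Langevin's
(abc-strength) inequality for the single form `2X³ − Y³`. [folklore] -/
def CubicValueRadicalBound : Prop :=
  ∀ ε : ℝ, 0 < ε → ∃ C : ℝ, ∀ n : ℤ,
    (((2 * n ^ 3 - 1).natAbs : ℕ) : ℝ) ≤ C * (radical (M := ℕ) (2 * n ^ 3 - 1).natAbs : ℝ) ^ (3 + ε)

/-- The LOGARITHMIC rung in the same currency with exponent `θ`:
`log|n| ≤ C(ε)·rad(2n³ − 1)^{θ+ε}` for all `n ≠ 0`, i.e. `rad(2n³−1) ≫ (log|n|)^{1/(θ+ε)}`. [folklore] -/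
def KillPencilLogRung (θ : ℝ) : Prop :=
  ∀ ε : ℝ, 0 < ε → ∃ C : ℝ, ∀ n : ℤ, n ≠ 0 →
    Real.log |(n : ℝ)| ≤ C * (radical (M := ℕ) (2 * n ^ 3 - 1).natAbs : ℝ) ^ (θ + ε)

/-! ### H1 — the `n`-free Siegel identity and its gcd witnesses (pure algebra, PROVED) -/

/-- H1a (S, PROVED): Vieta for the three roots of `X³ − 2` gives `∏ᵢ (αᵢ n − 1) = 2n³ − 1`. [folklore] -/
theorem siegel_product {R : Type*} [CommRing R] (α : Fin 3 → R) (n : R)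
    (he₁ : α 0 + α 1 + α 2 = 0) (he₂ : α 0 * α 1 + α 0 * α 2 + α 1 * α 2 = 0)
    (he₃ : α 0 * α 1 * α 2 = 2) :
    ∏ i, (α i * n - 1) = 2 * n ^ 3 - 1 := by
  simp only [Fin.prod_univ_three]
  linear_combination (n ^ 3) * he₃ - (n ^ 2) * he₂ + n * he₁

/-- H1b (S, PROVED): `αᵢ − αⱼ ∈ (αᵢn − 1) + (αⱼn − 1)` — the gcd of two members divides a ROOT DIFFERENCE,
a constant of norm `108` in `ℚ(∛2, ζ₃)` (independent of `n`). [folklore] -/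
theorem root_diff_mem_sup {R : Type*} [CommRing R] (α : Fin 3 → R) (n : R) (i j : Fin 3) :
    α i - α j ∈ Ideal.span {α i * n - 1} ⊔ Ideal.span {α j * n - 1} := by
  have h : α i - α j = α j * (α i * n - 1) + (-(α i)) * (α j * n - 1) := by ring
  rw [h]
  exact Submodule.add_mem_sup (Ideal.mul_mem_left _ _ (Ideal.mem_span_singleton_self _))
    (Ideal.mul_mem_left _ _ (Ideal.mem_span_singleton_self _))

/-- H1c (S, PROVED): `(αᵢ − αₖ)(αⱼ − αₖ) ∈ ((αᵢn − 1)(αⱼn − 1)) + (αₖn − 1)` (second gcd witness). [folklore] -/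
theorem root_diff_mul_mem_sup {R : Type*} [CommRing R] (α : Fin 3 → R) (n : R) (i j k : Fin 3) :
    (α i - α k) * (α j - α k) ∈
      Ideal.span {(α i * n - 1) * (α j * n - 1)} ⊔ Ideal.span {α k * n - 1} := by
  have h : (α i - α k) * (α j - α k) =
      (α k ^ 2) * ((α i * n - 1) * (α j * n - 1)) +
        (-(α k * α j * (α i * n - 1)) - α i * α k * (α j * n - 1) + α i * α j * (α k * n - 1)) *
          (α k * n - 1) := by ring
  rw [h]
  exact Submodule.add_mem_sup (Ideal.mul_mem_left _ _ (Ideal.mem_span_singleton_self _))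
    (Ideal.mul_mem_left _ _ (Ideal.mem_span_singleton_self _))

/-- H1d (S, PROVED): the three forms `αᵢu − w` are pairwise non-proportional iff the roots are distinct. [folklore] -/
theorem forms_nonproportional {R : Type*} [CommRing R] (α : Fin 3 → R)
    (hdist : ∀ i j, i ≠ j → α i ≠ α j) :
    ∀ i j, i ≠ j → α i * (-1 : R) ≠ α j * (-1 : R) := by
  intro i j hij h
  exact hdist i j hij (by simpa using h)

/-! ### H2, H3 — radical-norm bookkeeping (statements; one prover cycle together) -/

/-- H2 (M⁻, PROVED): for a rational integer `m ≠ 0`, `N(rad(m·𝓞_L)) ≤ rad(|m|)^{[L:ℚ]}` — because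
`(rad m)·𝓞_L ≤ rad(m·𝓞_L)` (`m ∣ (rad m)^k`), `absNorm` is antitone and `N((rad m)) = (rad m)^{[L:ℚ]}`
(`Ideal.absNorm_span_singleton`, `Algebra.norm_algebraMap`, `RingOfIntegers.rank`). [folklore] -/
theorem absNorm_radical_span_intCast_le (L : Type*) [Field L] [NumberField L] {m : ℤ} (hm : m ≠ 0) :
    Ideal.absNorm (Ideal.span {(m : 𝓞 L)}).radical ≤
      (radical (M := ℕ) m.natAbs) ^ Module.finrank ℚ L := by
  set r : ℕ := radical (M := ℕ) m.natAbs with hr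
  have hm' : m.natAbs ≠ 0 := Int.natAbs_ne_zero.mpr hm
  have hr0 : r ≠ 0 := (Nat.radical_pos _).ne'
  -- `(r) ≤ rad((m))` in `𝓞 L`, since `m ∣ r ^ |m|`
  have hle : Ideal.span {((r : ℤ) : 𝓞 L)} ≤ (Ideal.span {(m : 𝓞 L)}).radical := by
    rw [Ideal.span_singleton_le_iff_mem]
    have hdvd : m ∣ (r : ℤ) ^ m.natAbs := by
      have h1 : (m.natAbs : ℤ) ∣ ((r ^ m.natAbs : ℕ) : ℤ) :=
        Int.natCast_dvd_natCast.mpr (Nat.dvd_radical_pow_self hm')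
      rw [Int.natAbs_dvd] at h1
      exact_mod_cast h1
    obtain ⟨c, hc⟩ := hdvd
    refine ⟨m.natAbs, Ideal.mem_span_singleton.mpr ⟨(c : 𝓞 L), ?_⟩⟩
    have := congrArg (fun z : ℤ => (z : 𝓞 L)) hc
    simpa using this
  have hdvd := Ideal.absNorm_dvd_absNorm_of_le hle
  have hnorm : Ideal.absNorm (Ideal.span {((r : ℤ) : 𝓞 L)}) = r ^ Module.finrank ℚ L := by
    rw [Ideal.absNorm_span_singleton]
    have h1 : ((r : ℤ) : 𝓞 L) = algebraMap ℤ (𝓞 L) (r : ℤ) := by simp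
    rw [h1, Algebra.norm_algebraMap, NumberField.RingOfIntegers.rank, Int.natAbs_pow]
    simp
  have hpos : Ideal.absNorm (Ideal.span {((r : ℤ) : 𝓞 L)}) ≠ 0 := by
    rw [hnorm]; exact pow_ne_zero _ hr0
  calc Ideal.absNorm (Ideal.span {(m : 𝓞 L)}).radical
      ≤ Ideal.absNorm (Ideal.span {((r : ℤ) : 𝓞 L)}) := Nat.le_of_dvd (Nat.pos_of_ne_zero hpos) hdvd
    _ = r ^ Module.finrank ℚ L := hnorm

/-- H3 (S, PROVED): gcd-controlled super-multiplicativity of radical norms — if `d ≠ 0` lies in `(x) + (y)` then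
`N(rad x)·N(rad y) ≤ |N(d)|·N(rad(xy))`; from the identity `rad(x)·rad(y) = (rad x ⊔ rad y)·rad(xy)`
(proved inline in `NFPencilLemmas.absNorm_radical_span_mul_le`) and `(d) ≤ rad x ⊔ rad y`
(`Ideal.absNorm_dvd_absNorm_of_le`). [folklore] -/
theorem absNorm_radical_mul_le_of_mem {R : Type*} [CommRing R] [IsDedekindDomain R]
    [Module.Free ℤ R] [Module.Finite ℤ R] {x y d : R} (hd : d ≠ 0)
    (hmem : d ∈ Ideal.span {x} ⊔ Ideal.span {y}) :
    Ideal.absNorm (Ideal.span {x}).radical * Ideal.absNorm (Ideal.span {y}).radical ≤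
      Ideal.absNorm (Ideal.span {d}) * Ideal.absNorm (Ideal.span {x * y}).radical := by
  have hid : Ideal.absNorm (Ideal.span {x}).radical * Ideal.absNorm (Ideal.span {y}).radical =
      Ideal.absNorm ((Ideal.span {x}).radical ⊔ (Ideal.span {y}).radical) *
        Ideal.absNorm (Ideal.span {x * y}).radical := by
    rw [← map_mul, ← Ideal.sup_mul_inf, map_mul, ← Ideal.span_singleton_mul_span_singleton,
      Ideal.radical_mul, ← Ideal.radical_inf]
  rw [hid]
  refine Nat.mul_le_mul_right _ ?_
  have hsub : Ideal.span {x} ⊔ Ideal.span {y} ≤ (Ideal.span {x}).radical ⊔ (Ideal.span {y}).radical :=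
    sup_le_sup Ideal.le_radical Ideal.le_radical
  have hle : Ideal.span {d} ≤ (Ideal.span {x}).radical ⊔ (Ideal.span {y}).radical :=
    (Ideal.span_singleton_le_iff_mem _).mpr (hsub hmem)
  refine Nat.le_of_dvd (Nat.pos_of_ne_zero ?_) (Ideal.absNorm_dvd_absNorm_of_le hle)
  rw [Ne, Ideal.absNorm_eq_zero_iff, Ideal.span_singleton_eq_bot]
  exact hd

/-! ### RUNG — the engine on the kill pencil, over an abstract splitting field -/

/-- RUNG (M⁻, one prover cycle given H1–H3): Scoones' fact (via the LANDED
`NFPencilOfScoones.threeForms_of_scoones2021` with `K := L`, `αᵢ` the roots, `βᵢ := −1`, `(u,w) := (n,1)`)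
gives `log|n| ≤ C·(G₀G₁G₂)^{1/3+ε'}`, `Gᵢ = N(rad((αᵢn−1)𝓞_L))`; H3 twice with the witnesses H1b/H1c
(`N(α₀−α₁)`, `N((α₀−α₂)(α₁−α₂))` are constants) and H2 with H1a give `G₀G₁G₂ ≤ c_L · rad(2n³−1)^{[L:ℚ]}`;
take `ε' = ε/[L:ℚ]`. Over `L = ℚ(∛2, ζ₃)` the exponent is `6/3 = 2`. [cite: Scoones2023, Thm 3 — by name] -/
theorem killPencilLogRung_of_scoones2021
    (hS : scoones2021_abcNumberField_classNumberOne)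
    (L : Type) [Field L] [NumberField L] (hPID : IsPrincipalIdealRing (𝓞 L))
    (α : Fin 3 → 𝓞 L) (hdist : ∀ i j, i ≠ j → α i ≠ α j)
    (he₁ : α 0 + α 1 + α 2 = 0) (he₂ : α 0 * α 1 + α 0 * α 2 + α 1 * α 2 = 0)
    (he₃ : α 0 * α 1 * α 2 = 2) :
    KillPencilLogRung ((Module.finrank ℚ L : ℝ) / 3) := by
  sorry

/-- H0 (INPUT, not a one-cycle item): the splitting field `L = ℚ(∛2, ζ₃)` of `X³ − 2` is a sextic number
field of CLASS NUMBER ONE (LMFDB 6.0.34992.1: `|d_L| = 3·108²`; Minkowski bound `< 6`, the primes above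
`2`, `3` are `(∛2)` and `((1−ζ₃)/(1+∛2))`), carrying three distinct integral roots of `X³ − 2` with
`e₁ = e₂ = 0`, `e₃ = 2`. The class-number clause is the only non-routine part in Lean. [folklore] -/
def SplittingDataExists : Prop :=
  ∃ (L : Type) (_ : Field L) (_ : NumberField L),
    IsPrincipalIdealRing (𝓞 L) ∧ Module.finrank ℚ L = 6 ∧
      ∃ α : Fin 3 → 𝓞 L, (∀ i j, i ≠ j → α i ≠ α j) ∧
        α 0 + α 1 + α 2 = 0 ∧ α 0 * α 1 + α 0 * α 2 + α 1 * α 2 = 0 ∧ α 0 * α 1 * α 2 = 2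

/-- COROLLARY (kernel-checked composition, modulo RUNG and the inputs): Scoones' fact and H0 give the rung
with exponent `2`: `rad(2n³ − 1) ≫ (log|n|)^{1/(2+ε)}`. [cite: Scoones2023, Thm 3 — by name] -/
theorem killPencilLogRung_two (hS : scoones2021_abcNumberField_classNumberOne)
    (h0 : SplittingDataExists) : KillPencilLogRung 2 := by
  obtain ⟨L, _, _, hPID, hdeg, α, hdist, he₁, he₂, he₃⟩ := h0
  have h := killPencilLogRung_of_scoones2021 hS L hPID α hdist he₁ he₂ he₃
  have h6 : ((Module.finrank ℚ L : ℝ) / 3) = 2 := by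
    rw [hdeg]; norm_num
  rw [h6] at h
  exact h

/-- CAL (S, calibration, real arithmetic): the stub's consequence `CubicValueRadicalBound` (G13) is
POLYNOMIALLY stronger than every logarithmic rung: it gives `KillPencilLogRung θ` for every `θ > 0`
(`rad ≥ c·|n|^{3/(3+ε)}` ⇒ `rad^{θ+ε'} ≫ log|n|`). The engine reaches `θ = 2` only. [folklore] -/
theorem killPencilLogRung_of_cubicValueRadicalBound (h : CubicValueRadicalBound) {θ : ℝ} (hθ : 0 < θ) :
    KillPencilLogRung θ := by
  sorry

end Summit.ABC.ABC.Cruxes.IndexSzpiro.StubIdeas1G19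

end
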